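import Literature.MathematicalPhysics.QuantumFieldTheory.BalabanImbrieJaffe1984to88.BIJ88Ineq246Walks
import Literature.MathematicalPhysics.QuantumFieldTheory.BalabanImbrieJaffe1984to88.BIJ88WalkGeometryZd

/-!
# `BalabanImbrieJaffe1984to88.BIJ88Ineq247Walks` — T. Bałaban, J. Imbrie, A. Jaffe, *Effective action and cluster
properties of the abelian Higgs model*, Commun. Math. Phys. **114** (1988) 257–315 [BalabanImbrieJaffe1988]:
Sect. 2 p. 265, **(2.47)** `|C^{(k)}_{Λ,loc}(u; x₁, x₂) − C^{(k)}_Λ(u; x₁, x₂)| ≦ e^{−cr(e_k)}e^{−c|x₁−x₂|}` PROVED in the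
setting of [6] = [Balaban1983RegularityDecay] for the `C^{(k)}_{Λ,loc}` of `BIJ88RandomWalk242.cLoc` (seat p13) — the typed
row `BIJ88Sect2Statements.Close` («model instance»).

statement-level skeleton of published theorems with citation tags; proofs where landed; nothing here is a claim about the Yang–Mills mass gap

PDF held: `paper:balaban1988-cmp114-bij-abelian-higgs-effective-action` (journal page = PDF page + 256).  Page read as an
image (poppler ×3 crop of PDF p. 9 = journal 265).

TEXT UNDER FORMALIZATION (p. 265, verbatim): *"This estimate can be summed over all connected sets X to show that
|C^{(k)}_{Λ,loc}(u; x₁, x₂) − C^{(k)}_Λ(u; x₁, x₂)| ≦ e^{−cr(e_k)}e^{−c|x₁−x₂|}. (2.47)"*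

CITATION HEADER (lean-in-tree rule).  Part of the lit-balaban TYPED SKELETON (HOME `run/shared/lean/pub/lit-balaban/`),
Phase 2, seat p36 (gen 2, unit `lit-balaban-p36`); row **C2.Eq2.47** (typed by r18 p239939 as the shape
`BIJ88Sect2Statements.Close dist C_loc C δ c`, `δ = e^{−cr(e_k)}`).  Imports `BIJ88Ineq246Walks` (p36: the class-sum tail
`abs_tsum_walks_le_exp`, `eighth_le_len_of_not_near`) and through it `BIJ88RandomWalk242` (p13: `Walk`, `Eq242`, `Near`,
`cLoc`), `BIJ88WalkGeometry246` (p36) and `BIJ88WalkGeometryZd` (p36: the `ℤ^d` geometry); nothing restated.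
WHAT IS REPRODUCED, and how.  In the setting of [6] made explicit in `BIJ88Ineq246Walks` (walk kernels majorized by
`Aβⁿ` with end-point locality, out-degree `≤ D`, `Dβ ≤ e^{−δ}`, `≤ s₀` blocks per site, label distance with one unit per
step, `ldist` `μ`-Lipschitz, block radius `b₀`, primed radius with `s/8 ≤ (ρ − b₀)/μ`) plus a site distance `|x₁ − x₂|`
dominated through any label (`sd x₁ x₂ ≤ ldist i x₁ + ldist i x₂`, as in p13's `cLoc_eq_zero_of_far`), `μ ≤ 16M`,
`r(e_k) ≤ Ms` and `r(e_k)` LARGE (`s₀A/(1 − Dβ)·e^{δb₀/μ} ≤ e^{δs/32}`): `sub_cLoc_eq_tsum` (`C − C_loc` = the sum over the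
NON-primed walks, from (2.42) and (2.43) — the route does not need the sum over `X` of (2.45)/(2.46)),
`sdist_le_of_blocks` (`|x₁ − x₂| ≤ 2b₀ + μn` along a contributing walk of length `n`), and `close247`: the typed
`Close sd C_{Λ,loc} C (e^{−c·r(e_k)}) c` with the explicit `c = δ/(32M)` (both exponents with the SAME `c`, as printed).
§4 `ineq246_Zd` / `close247_Zd`: the rows (2.46) (`BIJ88Ineq246Walks.ineq246`) and (2.47) (`close247`) ON `ℤ^d` — labels
`pos : ι ↪ ℤ^d` with [6]'s `cubeAdj`, `r(e_k)`-cubes of side `ℓ`, sites of `ℤ^d` at `M′` per label unit, blocks of radius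
`M′t` — with every GEOMETRIC hypothesis discharged by `BIJ88WalkGeometryZd`; what remains are [6]'s analytic
hypotheses (majorant `Aβⁿ` with end-point locality, `3^dβ ≤ e^{−δ}`, `r(e_k)` large) exactly as in
`B4RandomWalk213.lattice_walk_decay_bound`.
§5 `walkTerm_hyps` / `ineq246_Zd_walkTerm` / `close247_Zd_walkTerm`: the same two rows for [6]'s OPERATOR walk terms
`a_{ω₀}b_{ω₁}⋯b_{ω_n}` (p13's `walkTerm`; `C = Σ_n G₀Rⁿ` with (2.42) by p13's `eq242_of_walkTerm`) read through additive
kernel maps `ev_{x₁x₂}` bounded by `E‖·‖` and END-POINT LOCAL; the majorant `Eα·βⁿ` and the nearest-neighbour/block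
support are DERIVED (`walkTerm_hyps`) from LOCAL factors with `‖a_i‖ ≤ α`, `‖b_i‖ ≤ β` — what remains of [6] is exactly its
Lemma 2.1 (the norms `α`, `β` with `3^dβ ≤ e^{−δ}`) and `‖R‖ < 1`.
NOT here: the operators `G(□_j)`, `h_j`, `K_j` themselves; the verification of `‖a_i‖ ≤ α`, `‖b_i‖ ≤ β`, `3^dβ < 1` for
the actual `C^{(k)}_Λ(u)` of (2.40) (the L²-bounds of [6] Lemma 2.1 and the lower bound (2.38)).
-/

namespace Literature.MathematicalPhysics.QuantumFieldTheory.BalabanImbrieJaffe1984to88.BIJ88Ineq247Walks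

open Finset
open Literature.MathematicalPhysics.QuantumFieldTheory.Balaban1983to89.B4RandomWalk213
open BIJ88RandomWalk242 BIJ88WalkGeometry246 BIJ88Ineq246Walks

variable {ι α : Type*} [Fintype ι] [DecidableEq ι]

/-! ## §1 `C − C_loc` is the sum over the non-primed walks -/

omit [Fintype ι] in
/-- **THE NON-LOCAL REMAINDER.**  By (2.42) (`Eq242`: the walk kernels sum unconditionally to `C(x₁,x₂)`) and (2.43)
(`cLoc` = the primed sub-sum), `C(x₁,x₂) − C^{(k)}_{Λ,loc}(x₁,x₂) = Σ″_ω C_ω(x₁,x₂)`, the sum over the walks NOT in `Σ′`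
(= `Σ_X C^{(k)}_{Λ,X}` by (2.45)). [cite: BalabanImbrieJaffe1988, (2.47) p.265] -/
theorem sub_cLoc_eq_tsum (ldist : ι → α → ℝ) (ρ : ℝ) (Cw : Walk ι → α → α → ℝ) {C : α → α → ℝ}
    (hC : Eq242 C Cw) (x₁ x₂ : α) :
    C x₁ x₂ - cLoc ldist ρ Cw x₁ x₂ =
      ∑' ω, {ω : Walk ι | ¬ Near ldist ρ ω x₁ x₂}.indicator (fun ω => Cw ω x₁ x₂) ω := by
  have hs : Summable fun ω : Walk ι => Cw ω x₁ x₂ := (hC x₁ x₂).summable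
  have h1 : Summable ({ω : Walk ι | Near ldist ρ ω x₁ x₂}.indicator fun ω => Cw ω x₁ x₂) := hs.indicator _
  have h2 : Summable ({ω : Walk ι | ¬ Near ldist ρ ω x₁ x₂}.indicator fun ω => Cw ω x₁ x₂) := hs.indicator _
  have hsplit : (fun ω : Walk ι => Cw ω x₁ x₂) = fun ω =>
      {ω : Walk ι | Near ldist ρ ω x₁ x₂}.indicator (fun ω => Cw ω x₁ x₂) ω +
        {ω : Walk ι | ¬ Near ldist ρ ω x₁ x₂}.indicator (fun ω => Cw ω x₁ x₂) ω := by
    funext ω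
    by_cases h : Near ldist ρ ω x₁ x₂
    · rw [Set.indicator_of_mem (show ω ∈ {ω : Walk ι | Near ldist ρ ω x₁ x₂} from h),
        Set.indicator_of_notMem (show ω ∉ {ω : Walk ι | ¬ Near ldist ρ ω x₁ x₂} from fun h' => h' h), add_zero]
    · rw [Set.indicator_of_notMem (show ω ∉ {ω : Walk ι | Near ldist ρ ω x₁ x₂} from h),
        Set.indicator_of_mem (show ω ∈ {ω : Walk ι | ¬ Near ldist ρ ω x₁ x₂} from h), zero_add]
  have hsum : HasSum (fun ω : Walk ι => Cw ω x₁ x₂)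
      ((∑' ω, {ω : Walk ι | Near ldist ρ ω x₁ x₂}.indicator (fun ω => Cw ω x₁ x₂) ω) +
        ∑' ω, {ω : Walk ι | ¬ Near ldist ρ ω x₁ x₂}.indicator (fun ω => Cw ω x₁ x₂) ω) := by
    have h := h1.hasSum.add h2.hasSum
    rwa [← hsplit] at h
  rw [(hC x₁ x₂).unique hsum]
  show _ - (∑' ω, {ω : Walk ι | Near ldist ρ ω x₁ x₂}.indicator (fun ω => Cw ω x₁ x₂) ω) = _
  ring

/-! ## §2 Sites in the end blocks of a short walk are close -/

omit [Fintype ι] [DecidableEq ι] in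
/-- **SHORT WALKS JOIN CLOSE SITES**: for a nearest-neighbour walk from a block of `x₁` to a block of `x₂` (blocks of
`ldist`-radius `b₀`, `ldist` `μ`-Lipschitz along the label distance, site distance dominated through any label:
`|x₁ − x₂| ≤ ldist(i,x₁) + ldist(i,x₂)`), `|x₁ − x₂| ≤ 2b₀ + μ·n` — the source of the factor `e^{−c|x₁−x₂|}` in (2.47)
(and of (2.41)). [cite: BalabanImbrieJaffe1988, (2.47) p.265] -/
theorem sdist_le_of_blocks (adj : ι → ι → Prop) (ldist : ι → α → ℝ) (inBlock : α → ι → Prop)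
    (d : ι → ι → ℝ) (hd0 : ∀ i, d i i = 0) (hdsymm : ∀ i l, d i l = d l i)
    (htri : ∀ i j l, d i l ≤ d i j + d j l) (hadj : ∀ i l, adj i l → d i l ≤ 1)
    {μ b₀ : ℝ} (hμ : 0 < μ) (hld : ∀ (i l : ι) (x : α), ldist l x ≤ ldist i x + μ * d i l)
    (hb : ∀ (x : α) (i : ι), inBlock x i → ldist i x ≤ b₀)
    (sd : α → α → ℝ) (hsd : ∀ (i : ι) (x₁ x₂ : α), sd x₁ x₂ ≤ ldist i x₁ + ldist i x₂)
    (ω : Walk ι) (hω : ω.IsNN adj) {x₁ x₂ : α} (h1 : inBlock x₁ ω.start) (h2 : inBlock x₂ ω.last) :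
    sd x₁ x₂ ≤ 2 * b₀ + μ * ω.len := by
  have hA := hsd ω.start x₁ x₂
  have hB := hld ω.last ω.start x₂
  have hC : d ω.last ω.start ≤ ω.len := by
    rw [hdsymm]
    have h0 := dist_ptAt_le d hd0 htri hadj hω (Nat.zero_le ω.len) le_rfl
    rw [ptAt_zero, Nat.sub_zero] at h0
    have hlast : ptAt ω.start ω.steps ω.len = ω.last := ptAt_length _ _
    rw [hlast] at h0
    exact h0
  have h1' := hb x₁ _ h1
  have h2' := hb x₂ _ h2
  nlinarith [mul_le_mul_of_nonneg_left hC hμ.le]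

/-! ## §3 (2.47) in the setting of [6] -/

/-- **(2.47) PROVED IN THE SETTING OF [6]** («model instance»), p. 265 [PDF 9], verbatim: *"This estimate can be summed
over all connected sets X to show that |C^{(k)}_{Λ,loc}(u; x₁, x₂) − C^{(k)}_Λ(u; x₁, x₂)| ≦ e^{−cr(e_k)}e^{−c|x₁−x₂|}.
(2.47)"* — for the `C^{(k)}_{Λ,loc}` of `BIJ88RandomWalk242.cLoc` and any `C` satisfying (2.42) (`Eq242 C C_ω`), under
the hypotheses of `BIJ88Ineq246Walks` (walk kernels majorized by `Aβⁿ` with end-point locality, out-degree `≤ D`,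
`Dβ ≤ e^{−δ}`, `≤ s₀` blocks per site, `ldist` `μ`-Lipschitz with `μ ≤ 16M`, block radius `b₀`, `s/8 ≤ (ρ − b₀)/μ`,
`r(e_k) ≤ Ms`) and `r(e_k)` LARGE (`s₀A/(1 − Dβ)·e^{δb₀/μ} ≤ e^{δs/32}`): the typed (2.47)
`BIJ88Sect2Statements.Close |·−·| C_{Λ,loc} C (e^{−c·r(e_k)}) c` with the explicit `c = δ/(32M)`.  Mechanism (no sum
over `X` is needed): `C − C_loc` is the sum over the NON-primed walks (`sub_cLoc_eq_tsum`); a contributing non-primed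
walk has length `≥ s/8` (`eighth_le_len_of_not_near`) and `≥ (|x₁−x₂| − 2b₀)/μ` (`sdist_le_of_blocks`), and the class
sums to a geometric tail (`abs_tsum_walks_le_exp`). [cite: BalabanImbrieJaffe1988, (2.47) p.265] -/
theorem close247 (adj : ι → ι → Prop) [DecidableRel adj] (ldist : ι → α → ℝ) (ρ : ℝ)
    (Cw : Walk ι → α → α → ℝ) {C : α → α → ℝ} (hC : Eq242 C Cw) (inBlock : α → ι → Prop)
    (d : ι → ι → ℝ) (hd0 : ∀ i, d i i = 0) (hdsymm : ∀ i l, d i l = d l i)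
    (htri : ∀ i j l, d i l ≤ d i j + d j l) (hadj : ∀ i l, adj i l → d i l ≤ 1)
    {s : ℕ} {μ b₀ : ℝ} (hμ : 0 < μ) (hld : ∀ (i l : ι) (x : α), ldist l x ≤ ldist i x + μ * d i l)
    (hb : ∀ (x : α) (i : ι), inBlock x i → ldist i x ≤ b₀) (hρ : (s : ℝ) / 8 ≤ (ρ - b₀) / μ)
    (sd : α → α → ℝ) (hsd0 : ∀ x₁ x₂, 0 ≤ sd x₁ x₂) (hsd : ∀ (i : ι) (x₁ x₂ : α), sd x₁ x₂ ≤ ldist i x₁ + ldist i x₂)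
    {A β δ : ℝ} {D s₀ : ℕ} (hA : 0 ≤ A) (hβ0 : 0 ≤ β)
    (hD : ∀ j, (Finset.univ.filter fun i => adj j i).card ≤ D) (hδ : 0 < δ) (hθ : (D : ℝ) * β ≤ Real.exp (-δ))
    (hmaj : ∀ ω x₁ x₂, |Cw ω x₁ x₂| ≤ A * β ^ ω.len)
    (hnz : ∀ ω x₁ x₂, Cw ω x₁ x₂ ≠ 0 → ω.IsNN adj ∧ inBlock x₁ ω.start ∧ inBlock x₂ ω.last)
    (hS₀ : ∀ x, ∃ S₀ : Finset ι, S₀.card ≤ s₀ ∧ ∀ i, inBlock x i → i ∈ S₀)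
    {M rek : ℝ} (hM : 0 < M) (hμM : μ ≤ 16 * M) (hs : rek ≤ M * s)
    (hlarge : s₀ * A / (1 - D * β) * Real.exp (δ * b₀ / μ) ≤ Real.exp (δ * s / 32)) :
    BIJ88Sect2Statements.Close sd (cLoc ldist ρ Cw) C (Real.exp (-(δ / (32 * M)) * rek)) (δ / (32 * M)) := by
  intro x₁ x₂
  -- the length bound for contributing non-primed walks
  set L : ℝ := ((s : ℝ) / 8 + (sd x₁ x₂ - 2 * b₀) / μ) / 2 with hL
  have hlen : ∀ ω ∈ {ω : Walk ι | ¬ Near ldist ρ ω x₁ x₂}, Cw ω x₁ x₂ ≠ 0 → L ≤ ω.len := by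
    intro ω hω hz
    obtain ⟨hnn, h1, h2⟩ := hnz ω x₁ x₂ hz
    have ha := eighth_le_len_of_not_near adj ldist ρ inBlock d hd0 hdsymm htri hadj hμ hld hb hρ ω hnn h1 h2 hω
    have hb' := sdist_le_of_blocks adj ldist inBlock d hd0 hdsymm htri hadj hμ hld hb sd hsd ω hnn h1 h2
    have hb'' : (sd x₁ x₂ - 2 * b₀) / μ ≤ ω.len := by
      rw [div_le_iff₀ hμ]
      linarith
    rw [hL]
    linarith
  have hbound := abs_tsum_walks_le_exp adj Cw inBlock hA hβ0 hD hδ hθ hmaj hnz hS₀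
    {ω : Walk ι | ¬ Near ldist ρ ω x₁ x₂} x₁ x₂ L hlen
  rw [abs_sub_comm, sub_cLoc_eq_tsum ldist ρ Cw hC x₁ x₂]
  refine hbound.trans ?_
  -- bookkeeping of the exponents
  have hK0 : 0 ≤ s₀ * A / (1 - (D : ℝ) * β) := by
    have he1 : Real.exp (-δ) < 1 := Real.exp_lt_one_iff.mpr (neg_lt_zero.mpr hδ)
    exact div_nonneg (mul_nonneg (Nat.cast_nonneg _) hA) (by linarith [hθ.trans_lt he1])
  have hsdx := hsd0 x₁ x₂
  have hexpL : Real.exp (-(δ * L)) =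
      Real.exp (δ * b₀ / μ) * (Real.exp (-(δ * s / 16)) * Real.exp (-(δ / (2 * μ) * sd x₁ x₂))) := by
    rw [← Real.exp_add, ← Real.exp_add, hL]
    congr 1
    field_simp
    ring
  have hc1 : δ / (32 * M) * sd x₁ x₂ ≤ δ / (2 * μ) * sd x₁ x₂ := by
    refine mul_le_mul_of_nonneg_right ?_ hsdx
    rw [div_le_div_iff₀ (by positivity) (by positivity)]
    nlinarith [hδ.le, hμM]
  have hc2 : δ / (32 * M) * rek ≤ δ * s / 32 := by
    rw [div_mul_eq_mul_div, div_le_div_iff₀ (by positivity) (by norm_num : (0:ℝ) < 32)]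
    have : δ * rek ≤ δ * (M * s) := mul_le_mul_of_nonneg_left hs hδ.le
    nlinarith [this, hM]
  calc s₀ * A / (1 - D * β) * Real.exp (-(δ * L))
      = s₀ * A / (1 - D * β) * Real.exp (δ * b₀ / μ) *
          (Real.exp (-(δ * s / 16)) * Real.exp (-(δ / (2 * μ) * sd x₁ x₂))) := by rw [hexpL]; ring
    _ ≤ Real.exp (δ * s / 32) * (Real.exp (-(δ * s / 16)) * Real.exp (-(δ / (2 * μ) * sd x₁ x₂))) :=
        mul_le_mul_of_nonneg_right hlarge (by positivity)
    _ = Real.exp (-(δ * s / 32)) * Real.exp (-(δ / (2 * μ) * sd x₁ x₂)) := by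
        rw [← mul_assoc, ← Real.exp_add]; ring_nf
    _ ≤ Real.exp (-(δ / (32 * M)) * rek) * Real.exp (-(δ / (32 * M)) * sd x₁ x₂) := by
        refine mul_le_mul ?_ ?_ (by positivity) (by positivity)
        · rw [Real.exp_le_exp]; linarith
        · rw [Real.exp_le_exp]; linarith

/-! ## §4 The instances on `ℤ^d` (geometry of `BIJ88WalkGeometryZd` discharged) -/

section Zd

open BIJ88WalkGeometryZd

variable {dd : ℕ}

/-- **(2.46) ON `ℤ^d`** («model instance», the geometry of [6] discharged): labels `pos : ι ↪ ℤ^d` of the `M`-cubes with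
[6]'s adjacency `cubeAdj`, `r(e_k)`-cubes of side `ℓ` labels (`cubeOf pos ℓ`, any boundary-layer relation `cadj` inside
touching), sites `x ∈ ℤ^d` at `M′` sites per label unit, blocks = labels within `M′t` of a site, primed radius `ρ` with
`ℓ/8 ≤ (ρ − M′t)/M′`; ANALYTIC HYPOTHESES as in [6]: walk kernels majorized by `Aβⁿ`, vanishing unless the walk is
nearest-neighbour from a block of `x₁` to a block of `x₂`, `3^dβ ≤ e^{−δ}`, and `r(e_k)` large
(`(2t+1)^d A/(1 − 3^dβ) ≤ exp(δℓ/(32·9^d))`, `r(e_k) ≤ Mℓ`).  CONCLUSION: the typed row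
`BIJ88Sect2Statements.Ineq246` for `BIJ88RandomWalk242.cX` with `|X| = X.card` and the explicit rate `δ/(32·9^d·M)`.
[cite: BalabanImbrieJaffe1988, (2.46) p.264] -/
theorem ineq246_Zd (pos : ι → Fin dd → ℤ) (hpos : Function.Injective pos) {ℓ M' : ℕ} (hℓ : 0 < ℓ) (hM' : 0 < M')
    (t : ℕ) (ρ : ℝ) (hρ : (ℓ : ℝ) / 8 ≤ (ρ - (M' : ℝ) * t) / M')
    (cadj : Cube pos ℓ → Cube pos ℓ → Prop) [DecidableRel cadj]
    (hcadj : ∀ c c', cadj c c' → cubeAdj Subtype.val c c')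
    (Cw : Walk ι → (Fin dd → ℤ) → (Fin dd → ℤ) → ℝ) {A β δ : ℝ} (hA : 0 ≤ A) (hβ0 : 0 ≤ β) (hδ : 0 < δ)
    (hθ : ((3 ^ dd : ℕ) : ℝ) * β ≤ Real.exp (-δ))
    (hmaj : ∀ ω x₁ x₂, |Cw ω x₁ x₂| ≤ A * β ^ ω.len)
    (hnz : ∀ ω x₁ x₂, Cw ω x₁ x₂ ≠ 0 → ω.IsNN (cubeAdj pos) ∧
      ldistZ M' pos ω.start x₁ ≤ (M' : ℝ) * t ∧ ldistZ M' pos ω.last x₂ ≤ (M' : ℝ) * t)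
    {M rek : ℝ} (hM : 0 < M) (hs : rek ≤ M * ℓ)
    (hlarge : ((2 * t + 1) ^ dd : ℕ) * A / (1 - ((3 ^ dd : ℕ) : ℝ) * β) ≤
      Real.exp (δ * ℓ / (32 * ((3 ^ dd : ℕ) : ℝ) * ((3 ^ dd : ℕ) : ℝ)))) :
    BIJ88Sect2Statements.Ineq246 (fun X : Finset (Cube pos ℓ) => X.card)
      (memX (fun x j => ldistZ M' pos j x ≤ (M' : ℝ) * t) (cubeOf pos ℓ) cadj)
      (cX (fun j x => ldistZ M' pos j x) ρ (cubeOf pos ℓ) cadj Cw)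
      (δ / (32 * ((3 ^ dd : ℕ) : ℝ) * ((3 ^ dd : ℕ) : ℝ) * M)) rek :=
  ineq246 (cubeAdj pos) (fun j x => ldistZ M' pos j x) ρ (cubeOf pos ℓ) cadj Cw
    (fun x j => ldistZ M' pos j x ≤ (M' : ℝ) * t) (fun i l => supDist (pos i) (pos l))
    (fun i => supDist_self _) (fun i l => supDist_comm _ _) (fun i j l => supDist_triangle _ _ _)
    (fun i l h => supDist_le_one_of_cubeAdj pos h) (cubeAdj Subtype.val) (touch_refl pos ℓ) (touch_symm pos ℓ)
    (card_touch_le pos ℓ) (card_closureNbhd_le pos ℓ cadj hcadj) (le_supDist_of_not_touch_cubeOf pos hℓ)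
    (by exact_mod_cast hM') (fun i l x => ldistZ_le M' pos i l x) (fun x i h => h) hρ hA hβ0
    (card_cubeAdj_le pos hpos) hδ hθ hmaj hnz (fun x => exists_blocks hM' t pos hpos x) hM hs hlarge

/-- **(2.47) ON `ℤ^d`** («model instance»): under the same dictionary and analytic hypotheses, with `M′ ≤ 16M` and
`r(e_k)` large in the form `(2t+1)^d A/(1 − 3^dβ)·e^{δt} ≤ e^{δℓ/32}`, the typed row `BIJ88Sect2Statements.Close` for
the sup-distance of sites, `BIJ88RandomWalk242.cLoc` and any `C` with (2.42) `Eq242 C C_ω`: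
`|C_{Λ,loc}(x₁,x₂) − C(x₁,x₂)| ≤ e^{−c·r(e_k)}e^{−c|x₁−x₂|}`, `c = δ/(32M)`.
[cite: BalabanImbrieJaffe1988, (2.47) p.265] -/
theorem close247_Zd (pos : ι → Fin dd → ℤ) (hpos : Function.Injective pos) {ℓ M' : ℕ} (hM' : 0 < M')
    (t : ℕ) (ρ : ℝ) (hρ : (ℓ : ℝ) / 8 ≤ (ρ - (M' : ℝ) * t) / M')
    (Cw : Walk ι → (Fin dd → ℤ) → (Fin dd → ℤ) → ℝ) {C : (Fin dd → ℤ) → (Fin dd → ℤ) → ℝ} (hC : Eq242 C Cw)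
    {A β δ : ℝ} (hA : 0 ≤ A) (hβ0 : 0 ≤ β) (hδ : 0 < δ) (hθ : ((3 ^ dd : ℕ) : ℝ) * β ≤ Real.exp (-δ))
    (hmaj : ∀ ω x₁ x₂, |Cw ω x₁ x₂| ≤ A * β ^ ω.len)
    (hnz : ∀ ω x₁ x₂, Cw ω x₁ x₂ ≠ 0 → ω.IsNN (cubeAdj pos) ∧
      ldistZ M' pos ω.start x₁ ≤ (M' : ℝ) * t ∧ ldistZ M' pos ω.last x₂ ≤ (M' : ℝ) * t)
    {M rek : ℝ} (hM : 0 < M) (hμM : (M' : ℝ) ≤ 16 * M) (hs : rek ≤ M * ℓ)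
    (hlarge : ((2 * t + 1) ^ dd : ℕ) * A / (1 - ((3 ^ dd : ℕ) : ℝ) * β) * Real.exp (δ * ((M' : ℝ) * t) / M') ≤
      Real.exp (δ * ℓ / 32)) :
    BIJ88Sect2Statements.Close supDist (cLoc (fun j x => ldistZ M' pos j x) ρ Cw) C
      (Real.exp (-(δ / (32 * M)) * rek)) (δ / (32 * M)) :=
  close247 (cubeAdj pos) (fun j x => ldistZ M' pos j x) ρ Cw hC (fun x j => ldistZ M' pos j x ≤ (M' : ℝ) * t)
    (fun i l => supDist (pos i) (pos l)) (fun i => supDist_self _) (fun i l => supDist_comm _ _)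
    (fun i j l => supDist_triangle _ _ _) (fun i l h => supDist_le_one_of_cubeAdj pos h) (by exact_mod_cast hM')
    (fun i l x => ldistZ_le M' pos i l x) (fun x i h => h) hρ supDist supDist_nonneg
    (fun i x₁ x₂ => supDist_le_ldistZ M' pos i x₁ x₂) hA hβ0 (card_cubeAdj_le pos hpos) hδ hθ hmaj hnz
    (fun x => exists_blocks hM' t pos hpos x) hM hμM hs hlarge

end Zd

/-! ## §5 The instances for [6]'s operator walk terms `a_{ω₀}b_{ω₁}⋯b_{ω_n}` read through kernel maps -/

section WalkTerm

variable {R : Type*} [NormedRing R]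

omit [Fintype ι] [DecidableEq ι] in
/-- END-POINT LOCALITY, right end: if the kernel map kills every `r·b_j` with `x₂` outside the block of `j`, it kills
the term of every walk of positive length ending at such a `j` ([6] (2.13): the last factor `K_{ω_n}G(□_{ω_n})h_{ω_n}`).
[cite: BalabanImbrieJaffe1988, (2.46) p.264] -/
theorem ev_mul_bprod_eq_zero_of_last (ev : R →+ ℝ) (b : ι → R) {Bad : ι → Prop}
    (hRt : ∀ (j : ι) (r : R), Bad j → ev (r * b j) = 0) :
    ∀ (n : ℕ) (x : R) (ys : Fin (n + 1) → ι), Bad (ys (Fin.last n)) → ev (x * bprod b (n + 1) ys) = 0 := by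
  intro n
  induction n with
  | zero =>
      intro x ys h
      rw [bprod_one]
      exact hRt _ x h
  | succ n ih =>
      intro x ys h
      rw [bprod_succ, ← mul_assoc]
      refine ih (x * b (ys 0)) (Fin.tail ys) ?_
      show Bad (ys (Fin.last n).succ)
      rw [Fin.succ_last]
      exact h

omit [Fintype ι] [DecidableEq ι] in
/-- **THE WALK KERNELS OF [6] SATISFY THE HYPOTHESES**: for `C_ω(x₁,x₂) = ev_{x₁x₂}(a_{ω₀}b_{ω₁}⋯b_{ω_n})` with LOCAL
factors (`a_ib_l = 0 = b_ib_l` unless `i ~ l`), `‖a_i‖ ≤ α`, `‖b_i‖ ≤ β`, kernel maps bounded by `E‖·‖` and END-POINT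
LOCAL (`ev_{x₁x₂}(a_i r) = 0` unless `x₁` lies in the block of `i`; `ev_{x₁x₂}(r b_j) = 0` and `ev_{x₁x₂}(a_j) = 0`
unless `x₂` lies in the block of `j`): the majorant `Eα·βⁿ` and the implication `C_ω(x₁,x₂) ≠ 0 ⇒ ω nearest-neighbour
from a block of x₁ to a block of x₂`. [cite: BalabanImbrieJaffe1988, (2.46) p.264] -/
theorem walkTerm_hyps (adj : ι → ι → Prop) {a b : ι → R} {α β E : ℝ}
    (hab : ∀ i l, ¬ adj i l → a i * b l = 0) (hbb : ∀ i l, ¬ adj i l → b i * b l = 0)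
    (hα : ∀ i, ‖a i‖ ≤ α) (hβ : ∀ i, ‖b i‖ ≤ β) (hE : 0 ≤ E) {α' : Type*} (ev : α' → α' → R →+ ℝ)
    (hev : ∀ x₁ x₂ r, |ev x₁ x₂ r| ≤ E * ‖r‖) (inBlock : α' → ι → Prop)
    (hL : ∀ x₁ x₂ i r, ¬ inBlock x₁ i → ev x₁ x₂ (a i * r) = 0)
    (hRt : ∀ x₁ x₂ j r, ¬ inBlock x₂ j → ev x₁ x₂ (r * b j) = 0)
    (hR0 : ∀ x₁ x₂ j, ¬ inBlock x₂ j → ev x₁ x₂ (a j) = 0) :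
    (∀ ω x₁ x₂, |ev x₁ x₂ (walkTerm a b ω)| ≤ E * α * β ^ ω.len) ∧
      ∀ ω x₁ x₂, ev x₁ x₂ (walkTerm a b ω) ≠ 0 → ω.IsNN adj ∧ inBlock x₁ ω.start ∧ inBlock x₂ ω.last := by
  refine ⟨fun ω x₁ x₂ => (hev x₁ x₂ _).trans ?_, fun ω x₁ x₂ hne => ⟨?_, ?_, ?_⟩⟩
  · have hβ0 : 0 ≤ β := (norm_nonneg _).trans (hβ ω.start)
    rw [mul_assoc]
    exact mul_le_mul_of_nonneg_left ((norm_mul_bprod_le hβ ω.len (a ω.start) ω.steps).trans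
      (mul_le_mul_of_nonneg_right (hα _) (pow_nonneg hβ0 _))) hE
  · by_contra h
    exact hne (by
      rw [show walkTerm a b ω = 0 from
        mul_bprod_eq_zero_of_not_isWalk hbb ω.len (fun l hl => hab _ l hl) h, map_zero])
  · by_contra h
    exact hne (hL x₁ x₂ ω.start _ h)
  · by_contra h
    rcases ω with ⟨s, n, ys⟩
    cases n with
    | zero =>
        refine hne ?_
        show ev x₁ x₂ (a s * bprod b 0 ys) = 0
        rw [bprod_zero, mul_one]
        exact hR0 x₁ x₂ s h
    | succ n =>
        exact hne (ev_mul_bprod_eq_zero_of_last (ev x₁ x₂) b (fun j r hj => hRt x₁ x₂ j r hj) n (a s) ys h)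

end WalkTerm

section WalkTermZd

open BIJ88WalkGeometryZd

variable {R : Type*} [NormedRing R] {dd : ℕ}

/-- **(2.46) FOR [6]'s OPERATORS ON `ℤ^d`** («model instance»): `C^{(k)}_{Λ,X}` built from the walk terms
`a_{ω₀}b_{ω₁}⋯b_{ω_n}` of [6] (2.13) read through end-point-local kernel maps bounded by `E‖·‖`, with LOCAL factors,
`‖a_i‖ ≤ α`, `‖b_i‖ ≤ β`, `3^dβ ≤ e^{−δ}`, labels `pos : ι ↪ ℤ^d`, `r(e_k)`-cubes of side `ℓ`, blocks of radius `M′t`,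
`ℓ/8 ≤ (ρ − M′t)/M′`, and `r(e_k)` large: the typed row `BIJ88Sect2Statements.Ineq246` with rate `δ/(32·9^d·M)`.
[cite: BalabanImbrieJaffe1988, (2.46) p.264] -/
theorem ineq246_Zd_walkTerm (pos : ι → Fin dd → ℤ) (hpos : Function.Injective pos) {ℓ M' : ℕ} (hℓ : 0 < ℓ)
    (hM' : 0 < M') (t : ℕ) (ρ : ℝ) (hρ : (ℓ : ℝ) / 8 ≤ (ρ - (M' : ℝ) * t) / M')
    (cadj : Cube pos ℓ → Cube pos ℓ → Prop) [DecidableRel cadj]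
    (hcadj : ∀ c c', cadj c c' → cubeAdj Subtype.val c c')
    {a b : ι → R} {α β δ E : ℝ} (hab : ∀ i l, ¬ cubeAdj pos i l → a i * b l = 0)
    (hbb : ∀ i l, ¬ cubeAdj pos i l → b i * b l = 0) (hα0 : 0 ≤ α) (hα : ∀ i, ‖a i‖ ≤ α) (hβ0 : 0 ≤ β)
    (hβ : ∀ i, ‖b i‖ ≤ β) (hE : 0 ≤ E) (ev : (Fin dd → ℤ) → (Fin dd → ℤ) → R →+ ℝ)
    (hev : ∀ x₁ x₂ r, |ev x₁ x₂ r| ≤ E * ‖r‖)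
    (hL : ∀ x₁ x₂ i r, ¬ ldistZ M' pos i x₁ ≤ (M' : ℝ) * t → ev x₁ x₂ (a i * r) = 0)
    (hRt : ∀ x₁ x₂ j r, ¬ ldistZ M' pos j x₂ ≤ (M' : ℝ) * t → ev x₁ x₂ (r * b j) = 0)
    (hR0 : ∀ x₁ x₂ j, ¬ ldistZ M' pos j x₂ ≤ (M' : ℝ) * t → ev x₁ x₂ (a j) = 0)
    (hδ : 0 < δ) (hθ : ((3 ^ dd : ℕ) : ℝ) * β ≤ Real.exp (-δ)) {M rek : ℝ} (hM : 0 < M) (hs : rek ≤ M * ℓ)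
    (hlarge : ((2 * t + 1) ^ dd : ℕ) * (E * α) / (1 - ((3 ^ dd : ℕ) : ℝ) * β) ≤
      Real.exp (δ * ℓ / (32 * ((3 ^ dd : ℕ) : ℝ) * ((3 ^ dd : ℕ) : ℝ)))) :
    BIJ88Sect2Statements.Ineq246 (fun X : Finset (Cube pos ℓ) => X.card)
      (memX (fun x j => ldistZ M' pos j x ≤ (M' : ℝ) * t) (cubeOf pos ℓ) cadj)
      (cX (fun j x => ldistZ M' pos j x) ρ (cubeOf pos ℓ) cadj fun ω x₁ x₂ => ev x₁ x₂ (walkTerm a b ω))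
      (δ / (32 * ((3 ^ dd : ℕ) : ℝ) * ((3 ^ dd : ℕ) : ℝ) * M)) rek := by
  obtain ⟨hmaj, hnz⟩ := walkTerm_hyps (cubeAdj pos) hab hbb hα hβ hE ev hev
    (fun x j => ldistZ M' pos j x ≤ (M' : ℝ) * t) hL hRt hR0
  exact ineq246_Zd pos hpos hℓ hM' t ρ hρ cadj hcadj _ (mul_nonneg hE hα0) hβ0 hδ hθ hmaj hnz hM hs hlarge

/-- **(2.47) FOR [6]'s OPERATORS ON `ℤ^d`** («model instance»): with `C = Σ_n G₀Rⁿ` ([6] (2.12): `‖R‖ < 1`,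
`G(1 − R) = G₀`, so that (2.42) holds by p13's `eq242_of_walkTerm`) and the hypotheses of `ineq246_Zd_walkTerm`, plus
`M′ ≤ 16M` and `r(e_k)` large: the typed row `BIJ88Sect2Statements.Close` for the kernels `ev_{x₁x₂}(C)` and
`C^{(k)}_{Λ,loc}`, `c = δ/(32M)`. [cite: BalabanImbrieJaffe1988, (2.47) p.265] -/
theorem close247_Zd_walkTerm [CompleteSpace R] (pos : ι → Fin dd → ℤ) (hpos : Function.Injective pos) {ℓ M' : ℕ}
    (hM' : 0 < M') (t : ℕ) (ρ : ℝ) (hρ : (ℓ : ℝ) / 8 ≤ (ρ - (M' : ℝ) * t) / M') {a b : ι → R} {G : R}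
    {α β δ E : ℝ} (hab : ∀ i l, ¬ cubeAdj pos i l → a i * b l = 0) (hbb : ∀ i l, ¬ cubeAdj pos i l → b i * b l = 0)
    (hα0 : 0 ≤ α) (hα : ∀ i, ‖a i‖ ≤ α) (hβ0 : 0 ≤ β) (hβ : ∀ i, ‖b i‖ ≤ β) (hR : ‖∑ i, b i‖ < 1)
    (hG : G * (1 - ∑ i, b i) = ∑ i, a i) (hE : 0 ≤ E)
    (ev : (Fin dd → ℤ) → (Fin dd → ℤ) → R →+ ℝ) (hev : ∀ x₁ x₂ r, |ev x₁ x₂ r| ≤ E * ‖r‖)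
    (hL : ∀ x₁ x₂ i r, ¬ ldistZ M' pos i x₁ ≤ (M' : ℝ) * t → ev x₁ x₂ (a i * r) = 0)
    (hRt : ∀ x₁ x₂ j r, ¬ ldistZ M' pos j x₂ ≤ (M' : ℝ) * t → ev x₁ x₂ (r * b j) = 0)
    (hR0 : ∀ x₁ x₂ j, ¬ ldistZ M' pos j x₂ ≤ (M' : ℝ) * t → ev x₁ x₂ (a j) = 0)
    (hδ : 0 < δ) (hθ : ((3 ^ dd : ℕ) : ℝ) * β ≤ Real.exp (-δ)) {M rek : ℝ} (hM : 0 < M)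
    (hμM : (M' : ℝ) ≤ 16 * M) (hs : rek ≤ M * ℓ)
    (hlarge : ((2 * t + 1) ^ dd : ℕ) * (E * α) / (1 - ((3 ^ dd : ℕ) : ℝ) * β) *
      Real.exp (δ * ((M' : ℝ) * t) / M') ≤ Real.exp (δ * ℓ / 32)) :
    BIJ88Sect2Statements.Close supDist
      (cLoc (fun j x => ldistZ M' pos j x) ρ fun ω x₁ x₂ => ev x₁ x₂ (walkTerm a b ω))
      (fun x₁ x₂ => ev x₁ x₂ G) (Real.exp (-(δ / (32 * M)) * rek)) (δ / (32 * M)) := by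
  obtain ⟨hmaj, hnz⟩ := walkTerm_hyps (cubeAdj pos) hab hbb hα hβ hE ev hev
    (fun x j => ldistZ M' pos j x ≤ (M' : ℝ) * t) hL hRt hR0
  have hevc : ∀ x₁ x₂, Continuous (ev x₁ x₂) := fun x₁ x₂ =>
    AddMonoidHomClass.continuous_of_bound (ev x₁ x₂) E fun r => by
      rw [Real.norm_eq_abs]
      exact hev x₁ x₂ r
  have he1 : Real.exp (-δ) < 1 := Real.exp_lt_one_iff.mpr (neg_lt_zero.mpr hδ)
  have hDβ : ((3 ^ dd : ℕ) : ℝ) * β < 1 := hθ.trans_lt he1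
  have hC := eq242_of_walkTerm (cubeAdj pos) hab hbb hα hβ (card_cubeAdj_le pos hpos) hDβ hR hG ev hevc
  exact close247_Zd pos hpos hM' t ρ hρ _ hC (mul_nonneg hE hα0) hβ0 hδ hθ hmaj hnz hM hμM hs hlarge

end WalkTermZd

end Literature.MathematicalPhysics.QuantumFieldTheory.BalabanImbrieJaffe1984to88.BIJ88Ineq247Walks
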